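import Summits.CriticalPhenomena.PercolationContinuityZ3.Theorems.PercNearOneGluingNoHeavyQuantTargetPropertyThinAt
import Literature.Probability.Percolation.KozmaNitzanCorridor
import HarnessLib

/-!
# QUANT lane (R2, step S3 thin): Kozma–Nitzan's Lemmas 11 and 12 with LINEAR loss from the target property for
# TRANSVERSALLY BOUNDED subboxes

builds on p205010 (kernel theorem, internal audit signed; external expert review pending)

Cell `prim-quant` (post-continuity programme, LANE 1), seat `prim-quant-p2` (METHOD = effective Kozma–Nitzan
reduction), memo `run/shared/lean/prim/quant/P2-EFFECTIVE-KN.md` §2.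

Same statements and proofs as `…QuantLevelChain.lean` (`levelStep_linear`, `levelChain_linear`, `elongHit_linear`)
and `…QuantCorridor.lean` (`halvingStep_linear`, `halvingChain_linear`, `corridorStep_linear`, `corridorLemma_linear`),
with the input families weakened from `TargetPropertyAt` to `TargetPropertyThinAt … w` (the target property demanded
only for subboxes of transversal half-width `≤ w`, file `…QuantTargetPropertyThinAt.lean`), which is what bounded-range
hittability supplies (`Quant.targetLemma_thin`).  Each application discharges the thinness of its subbox: the region
of Lemma 11 (`E.region L s`, half-width `E.r`), the near cube (`5r`) and the corridor box `Dcorr` (`2r`) of Lemma 12.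

* `Quant.levelStep_thin`, `Quant.levelChain_thin`, `Quant.elongHit_thin` (Lemma 11, needs `E.r ≤ w` / `r ≤ w`);
* `Quant.halvingStep_thin`, `Quant.halvingChain_thin`, `Quant.corridorStep_thin`, `Quant.corridorLemma_thin`
  (Lemma 12, needs `5·S.r ≤ w`).
No definitions; no sorries; standard axioms.  [cite: KozmaNitzan2024, §4 Lemmas 11–12 (pp. 22–25)]
-/

noncomputable section

namespace Summit.CriticalPhenomena.PercolationContinuityZ3.Theorems.Quant

open MeasureTheory Literature.Probability.LatticeModels Literature.Probability.Percolation
  Literature.Probability.Percolation.KozmaNitzan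

variable {d : ℕ}

/-- **One step of Lemma 11, linear form, thin input**: for an admissible step (`EData.StepOK E R₀ R L s w`) and a linear
family of target properties for the quarter-face geometries with margin `R₀` and loss `η`,
`1 − δ' < P_Ω(0 ↔ face(L, w))` implies `1 − (δ' + η) < P_Ω(0 ↔ face(L+s, w+R))` (the tree's
`EData.levelStep_of_target`, same geometric inputs).
builds on p205010 (kernel theorem, internal audit signed; external expert review pending).
[cite: KozmaNitzan2024, §4 pp. 22–23] -/
theorem levelStep_thin [NeZero d] (p : unitInterval) {η : ℝ} {R₀ : ℕ}
    {wth : ℕ} (hT : ∀ δ' : ℝ, TargetPropertyThinAt d p (δ' + η) δ' (qfList d) R₀ wth)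
    (E : EData d) (hEw : E.r ≤ wth) (R : ℕ) (L s w : ℤ) (hok : EData.StepOK E R₀ R L s w) {δ' : ℝ}
    (hB : 1 - δ' < (prodBernoulli (E.W p)).real (⋃ b ∈ E.face L w, openConn (0 : Site d) b)) :
    1 - (δ' + η) < (prodBernoulli (E.W p)).real (⋃ b ∈ E.face (L + s) (w + R), openConn (0 : Site d) b) :=
  hT δ' (E.W p) E.bigBox (E.region L s) (sLo E.a E.σ 0 L L w) (sHi E.a E.σ 0 L L w)
    (E.face (L + s) (w + R)) 0 (E.finSupp_W p hok.hkr hok.hK1) (EData.isSubbox_region hok p)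
    (EData.region_subset_bigBox hok) E.zero_mem_bigBox (EData.zero_not_mem_region hok)
    ⟨E.a, 0, fun y hy i hi => by
      have h := ((E.mem_region_iff).1 hy).2 i hi
      have hw' : (E.r : ℤ) ≤ wth := by exact_mod_cast hEw
      simp only [Pi.zero_apply, zero_sub, zero_add]
      exact ⟨by linarith [h.1], by linarith [h.2]⟩⟩
    (EData.enlarge_face_subset_region hok) (EData.isTarget_step hok) (EData.face_subset_region hok)
    (EData.face_nonempty hok) hB

/-- **The chain of Lemma 11, linear form, thin input**: `N` admissible steps (`EData.ChainOK E R₀ R N L s w`) turn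
`1 − δ' < P_Ω(0 ↔ face(L, w))` into `1 − (δ' + N·η) < P_Ω(0 ↔ face(L + Ns, w + NR))` — the losses ADD
(the tree's `EData.levelChain_of_target` nests them).
builds on p205010 (kernel theorem, internal audit signed; external expert review pending).
[cite: KozmaNitzan2024, §4 p. 23] -/
theorem levelChain_thin [NeZero d] (p : unitInterval) {η : ℝ} {R₀ : ℕ}
    {wth : ℕ} (hT : ∀ δ' : ℝ, TargetPropertyThinAt d p (δ' + η) δ' (qfList d) R₀ wth) (N : ℕ) :
    ∀ (E : EData d), E.r ≤ wth → ∀ (R : ℕ) (L s w : ℤ), EData.ChainOK E R₀ R N L s w → ∀ {δ' : ℝ},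
      1 - δ' < (prodBernoulli (E.W p)).real (⋃ b ∈ E.face L w, openConn (0 : Site d) b) →
        1 - (δ' + N * η) < (prodBernoulli (E.W p)).real
          (⋃ b ∈ E.face (L + N * s) (w + N * R), openConn (0 : Site d) b) := by
  induction N with
  | zero =>
    intro E _ R L s w _ δ' hB
    simpa using hB
  | succ N ih =>
    intro E hEw R L s w hok δ' hB
    have step := levelStep_thin p hT E hEw R L s w (hok.stepOK hok.hR) hB
    have rest := ih E hEw R (L + s) s (w + R) hok.shift step
    have e1 : L + s + (N : ℤ) * s = L + ((N + 1 : ℕ) : ℤ) * s := by push_cast; ring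
    have e2 : w + (R : ℤ) + (N : ℤ) * R = w + ((N + 1 : ℕ) : ℤ) * R := by push_cast; ring
    have e3 : δ' + η + (N : ℝ) * η = δ' + ((N + 1 : ℕ) : ℝ) * η := by push_cast; ring
    rw [e1, e2, e3] at rest
    exact rest

/-! ## Lemma 11 with scale-indexed inputs (thin) -/

/-- **Kozma–Nitzan's Lemma 11 with LINEAR loss and scale-indexed inputs, thin target property (`r ≤ wth`).**  Data: direction `a`, sign `σ`,
aspect `K ≥ 2`, a linear family of target properties for the quarter faces (margin `R₀`, loss `η`), a seed
radius `k` and a threshold `n₁`.  If `Λ_k` is joined inside `Λ_n` to every face orthant of `Λ_n` with probability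
`> 1 − δ'` for every `n ∈ [n₁, r]` (KN Lemma 9 on a bounded range), then for every `r ≥ 8(3K + 3KR₀ + k + n₁ + 8)`
and every `m ≥ k`, the elongated box `{-r ≤ σx_a ≤ Kr, |x_j| ≤ r}` is crossed from `Λ_m` to its far face
`{σ x_a = Kr}` with probability `> 1 − (δ' + (8K−4)·η)`.  Proof: the tree's proof of
`isHittable_elongGeom_of_target` (start from the full face of `Λ_{L₀}`, `L₀ = Kr − (8K−4)⌊r/8⌋ ≤ r`, reached from
`Λ_k`; `8K − 4` steps of `levelChain_thin` in `Ω`; back to `P_p` by `EData.real_W_biUnion_openConn`).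
builds on p205010 (kernel theorem, internal audit signed; external expert review pending).
[cite: KozmaNitzan2024, §4 Lemma 11 (pp. 22–23)] -/
theorem elongHit_thin [NeZero d] (p : unitInterval) {η : ℝ} {R₀ : ℕ}
    {wth : ℕ} (hT : ∀ δ' : ℝ, TargetPropertyThinAt d p (δ' + η) δ' (qfList d) R₀ wth)
    (a : Fin d) (σ : ℤˣ) (K : ℕ) (hK : 2 ≤ K) {k n₁ r m : ℕ} (hrw : r ≤ wth) {δ' : ℝ}
    (hlink : ∀ n : ℕ, n₁ ≤ n → n ≤ r → ∀ (a' : Fin d) (τ : Fin d → ℤˣ),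
      1 - δ' < (bondPercolation (zdGraph d) p).real (linkEvent (box d k) (orthantFace a' τ n) n))
    (hr : 8 * (3 * K + 3 * K * R₀ + k + n₁ + 8) ≤ r) (hm : k ≤ m) :
    1 - (δ' + (8 * K - 4 : ℕ) * η) < (bondPercolation (zdGraph d) p).real
      (linkIn (↑((elongGeom a σ K (by omega)).Qset r 0)) (box d m) ((elongGeom a σ K (by omega)).Fset r 0)) := by
  have hK1 : 1 ≤ K := by omega
  set N : ℕ := 8 * K - 4 with hNdef
  have hN : (N : ℤ) = 8 * K - 4 := by rw [hNdef]; omega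
  set A : ℕ := 3 * K + 3 * K * R₀ + k + n₁ + 8 with hAdef
  rw [elongGeom_Qset a σ K hK1 k r, elongGeom_Fset a σ K hK1 k r]
  -- the parameters of the chain
  set s : ℕ := r / 8 with hsdef
  have hs1 : 8 * s ≤ r := Nat.mul_div_le r 8
  have hs2 : r < 8 * s + 8 := by
    have := Nat.div_add_mod r 8; have := Nat.mod_lt r (show 0 < 8 by norm_num); omega
  have hAs : A ≤ s := by
    rw [hsdef]; exact (Nat.le_div_iff_mul_le (by norm_num)).2 (by linarith)
  set E : EData d := elongData a σ K r k with hE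
  set L₀ : ℤ := K * r - N * s with hL₀
  -- casts
  have hK' : (2 : ℤ) ≤ K := by exact_mod_cast hK
  have hs1' : 8 * (s : ℤ) ≤ r := by exact_mod_cast hs1
  have hs2' : (r : ℤ) < 8 * s + 8 := by exact_mod_cast hs2
  have hAs' : (A : ℤ) ≤ s := by exact_mod_cast hAs
  have hA' : (A : ℤ) = 3 * K + 3 * K * R₀ + k + n₁ + 8 := by rw [hAdef]; push_cast; ring
  have hKr1 : (K : ℤ) * (8 * s) ≤ K * r := mul_le_mul_of_nonneg_left hs1' (by positivity)
  have hKr2 : (K : ℤ) * r ≤ K * (8 * s + 8) := mul_le_mul_of_nonneg_left hs2'.le (by positivity)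
  have hKR0 : (0 : ℤ) ≤ K * R₀ := by positivity
  have hNs : (N : ℤ) * s = 8 * (K * s) - 4 * s := by rw [hN]; ring
  have hNR : (N : ℤ) * R₀ = 8 * (K * R₀) - 4 * R₀ := by rw [hN]; ring
  have hKR : (R₀ : ℤ) ≤ K * R₀ := by
    have : (1 : ℤ) * R₀ ≤ K * R₀ := mul_le_mul_of_nonneg_right (by linarith) (by positivity)
    linarith
  have hrK : (r : ℤ) ≤ K * r := by
    have : (1 : ℤ) * r ≤ K * r := mul_le_mul_of_nonneg_right (by linarith) (by positivity)
    linarith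
  have hL₀lo : 4 * (s : ℤ) ≤ L₀ := by rw [hL₀]; linarith
  have hL₀hi : L₀ ≤ 4 * (s : ℤ) + 8 * K := by rw [hL₀]; linarith
  have hL₀r : L₀ ≤ r := by linarith
  -- the chain conditions
  have hok : EData.ChainOK E R₀ R₀ N L₀ s L₀ :=
    { hR := le_rfl
      hs := by linarith
      hw := by linarith
      hr := by
        show L₀ + (N : ℤ) * R₀ + s + 2 * R₀ ≤ (r : ℤ)
        linarith
      hk := by
        show ((k : ℕ) : ℤ) < L₀ - 2 * s
        linarith
      hK := by
        show L₀ + (N : ℤ) * s ≤ (K : ℤ) * r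
        rw [hL₀]; linarith
      hkr := by
        show k ≤ r
        have : (k : ℤ) ≤ r := by linarith
        exact_mod_cast this
      hK1 := by show 1 ≤ K; omega }
  -- the initial face: a full face of the cube `Λ_{L₀}` is reached from `Λ_k` (hypothesis `hlink`)
  have hL₀0 : 0 ≤ L₀ := by linarith
  set L₀' : ℕ := L₀.toNat with hL₀'
  have hL₀cast : (L₀' : ℤ) = L₀ := Int.toNat_of_nonneg hL₀0
  have hn₁ : n₁ ≤ L₀' := by
    have : (n₁ : ℤ) ≤ L₀' := by rw [hL₀cast]; linarith
    exact_mod_cast this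
  have hL₀'r : L₀' ≤ r := by
    have : (L₀' : ℤ) ≤ r := by rw [hL₀cast]; exact hL₀r
    exact_mod_cast this
  set τ₀ : Fin d → ℤˣ := fun _ => σ with hτ₀
  have hinit : 1 - δ' < (prodBernoulli (E.W p)).real (⋃ b ∈ E.face L₀ L₀, openConn (0 : Site d) b) := by
    rw [E.real_W_biUnion_openConn p hok.hkr hok.hK1]
    refine (hlink L₀' hn₁ hL₀'r a τ₀).trans_le (measureReal_mono ?_ (measure_ne_top _ _))
    rintro ω ⟨y, hy, x, hx, hω⟩
    simp only [Set.mem_iUnion, exists_prop, Finset.mem_coe]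
    refine ⟨x, ?_, y, hy, ?_⟩
    · -- the face orthant lies on the full face
      rw [mem_orthantFace, mem_box] at hx
      obtain ⟨hxb, hxa, -⟩ := hx
      rw [EData.mem_face_iff]
      refine ⟨?_, fun j _ => ?_⟩
      · change (σ : ℤ) * x a = L₀
        rw [← hL₀cast, ← hxa]
      · have := hxb j; rw [hL₀cast] at this; exact this
    · -- `Λ_{L₀} ⊆` the elongated box
      rw [DCT16.mem_openConnIn_iff_pathIn] at hω ⊢
      refine hω.mono fun z hz => ?_
      rw [Finset.mem_coe, mem_box] at hz
      rw [Finset.mem_coe, EData.mem_bigBox_iff]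
      have hza := level_bounds_of_symm E.hσ (hz a).1 (hz a).2
      change (-(r : ℤ) ≤ E.σ * z a ∧ E.σ * z a ≤ K * r) ∧ ∀ j, j ≠ a → -(r : ℤ) ≤ z j ∧ z j ≤ r
      rw [hL₀cast] at hza
      refine ⟨⟨by linarith [hza.1], by linarith [hza.2]⟩, fun j _ => ?_⟩
      have := hz j; rw [hL₀cast] at this
      constructor <;> linarith [this.1, this.2]
  -- the chain
  have hend := levelChain_thin p hT N E hrw R₀ L₀ s L₀ hok hinit
  have hlev : L₀ + (N : ℤ) * s = r * K := by rw [hL₀]; ring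
  rw [hlev, E.real_W_biUnion_openConn p hok.hkr hok.hK1] at hend
  -- back to the geometry
  have hwid : L₀ + (N : ℤ) * R₀ ≤ r := by
    have h1 : L₀ + (N : ℤ) * R₀ + s + 2 * R₀ ≤ (r : ℤ) := hok.hr
    have h2 : (0 : ℤ) ≤ s := by positivity
    have h3 : (0 : ℤ) ≤ R₀ := by positivity
    linarith
  refine hend.trans_le (measureReal_mono ?_ (measure_ne_top _ _))
  intro ω hω
  simp only [Set.mem_iUnion, exists_prop, Finset.mem_coe] at hω
  obtain ⟨t, ht, y, hy, hω⟩ := hω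
  refine ⟨y, box_mono d hm hy, t, ?_, hω⟩
  rw [EData.mem_face_iff] at ht ⊢
  refine ⟨ht.1, fun j hj => ?_⟩
  have h2 := ht.2 j hj
  change -(r : ℤ) ≤ t j ∧ t j ≤ r
  constructor <;> linarith [h2.1, h2.2]

/-- **One halving step, linear form, thin input (`5r ≤ wth`)** (tree `CData.halvingStep_of_target`, same geometric inputs): with a linear
family of target properties for the quarter faces (margin `R₀`, loss `η`), reaching `B_k` from `o` in the
weighting restricted to `A` with probability `> 1 − δ'` forces reaching `B_{k+1}` with probability `> 1 − (δ' + η)`.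
builds on p205010 (kernel theorem, internal audit signed; external expert review pending).
[cite: KozmaNitzan2024, §4 p. 24] -/
theorem halvingStep_thin [NeZero d] (p : unitInterval) {η : ℝ} {R₀ : ℕ}
    {wth : ℕ} (hT : ∀ δ' : ℝ, TargetPropertyThinAt d p (δ' + η) δ' (qfList d) R₀ wth)
    (S : CData d) (hS : S.Hyp p) (hSw : 5 * S.r ≤ wth) (k R : ℕ) (hk : k < d) (hR : R₀ ≤ R) (hRlh : R₀ ≤ S.lh)
    (hfit : ((S.r + 1) / 2 : ℕ) + (k : ℤ) * R + R ≤ S.r) {δ' : ℝ}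
    (hB : 1 - δ' < (prodBernoulli (restrW (↑S.Aset : Set (Site d)) S.W)).real (⋃ b ∈ S.Bk k R, openConn S.o b)) :
    1 - (δ' + η) < (prodBernoulli (restrW (↑S.Aset : Set (Site d)) S.W)).real
      (⋃ b ∈ S.Bk (k + 1) R, openConn S.o b) := by
  have hR' : (R₀ : ℤ) ≤ R := by exact_mod_cast hR
  have hfit0 : ((S.r + 1) / 2 : ℕ) + (k : ℤ) * R + R₀ ≤ S.r := by linarith
  have hkR : (k : ℤ) * R + R₀ ≤ 2 * S.r := by
    have : (0 : ℤ) ≤ ((S.r + 1) / 2 : ℕ) := by positivity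
    linarith
  have hkR1 : ((k + 1 : ℕ) : ℤ) * R ≤ 2 * S.r := by push_cast; linarith
  exact hT δ' (restrW (↑S.Aset : Set (Site d)) S.W) S.Aset S.nearQ (S.c - S.hwid k R) (S.c + S.hwid k R)
    (S.Bk (k + 1) R) S.o (finSupp_restrW S.Aset S.W)
    ((CData.isSubbox_nearQ hS).restrW (Finset.coe_subset.2 (CData.nearQ_subset_Aset hS)))
    (CData.nearQ_subset_Aset hS) (CData.o_mem_Aset hS) (CData.o_not_mem_nearQ hS)
    ⟨S.a, S.c, fun y hy i _ => by
      have h := (S.mem_nearQ_iff).1 hy i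
      have hw' : (5 * S.r : ℤ) ≤ wth := by exact_mod_cast hSw
      exact ⟨by linarith [h.1], by linarith [h.2]⟩⟩
    (S.enlarge_Bk_subset_nearQ hkR)
    (S.isTarget_halving hk hR hRlh hfit0) (S.Bk_subset_nearQ hkR1) (S.Bk_nonempty _ _) hB

/-- **The halving chain, linear form, thin input** (tree `CData.halvingChain_of_target`): `n` halving steps from `B_k` to
`B_{k+n}` (`k + n ≤ d`) cost `n·η`.
builds on p205010 (kernel theorem, internal audit signed; external expert review pending).
[cite: KozmaNitzan2024, §4 p. 24 ("We continue this way, each time halving one dimension")] -/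
theorem halvingChain_thin [NeZero d] (p : unitInterval) {η : ℝ} {R₀ : ℕ}
    {wth : ℕ} (hT : ∀ δ' : ℝ, TargetPropertyThinAt d p (δ' + η) δ' (qfList d) R₀ wth) (n : ℕ) :
    ∀ (S : CData d), S.Hyp p → 5 * S.r ≤ wth → ∀ (k R : ℕ), k + n ≤ d → R₀ ≤ R → R₀ ≤ S.lh →
      ((S.r + 1) / 2 : ℕ) + (d : ℤ) * R + R ≤ S.r → ∀ {δ' : ℝ},
      1 - δ' < (prodBernoulli (restrW (↑S.Aset : Set (Site d)) S.W)).real (⋃ b ∈ S.Bk k R, openConn S.o b) →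
        1 - (δ' + n * η) < (prodBernoulli (restrW (↑S.Aset : Set (Site d)) S.W)).real
          (⋃ b ∈ S.Bk (k + n) R, openConn S.o b) := by
  induction n with
  | zero =>
    intro S _ _ k R _ _ _ _ δ' hB
    simpa using hB
  | succ n ih =>
    intro S hS hSw k R hkn hR hRlh hfit δ' hB
    have hfitk : ((S.r + 1) / 2 : ℕ) + (k : ℤ) * R + R ≤ S.r := by
      have : (k : ℤ) * R ≤ (d : ℤ) * R :=
        mul_le_mul_of_nonneg_right (by exact_mod_cast (by omega : k ≤ d)) (by positivity)
      linarith
    have step := halvingStep_thin p hT S hS hSw k R (by omega) hR hRlh hfitk hB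
    have rest := ih S hS hSw (k + 1) R (by omega) hR hRlh hfit step
    have e : k + 1 + n = k + (n + 1) := by ring
    have e' : δ' + η + (n : ℝ) * η = δ' + ((n + 1 : ℕ) : ℝ) * η := by push_cast; ring
    rw [e, e'] at rest
    exact rest

/-- **The corridor step, linear form, thin input (`2r ≤ wth`)** (tree `CData.corridorStep_of_target`, same geometric inputs): with a
linear family of target properties for the aspect-`88` elongated geometries (margin `R₀'`, loss `η'`), reaching
the small cube `B_d` from `o` in `U` with probability `> 1 − δ'` forces reaching `c' + [-2r,2r]^d` in `U` with
probability `> 1 − (δ' + η')`.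
builds on p205010 (kernel theorem, internal audit signed; external expert review pending).
[cite: KozmaNitzan2024, §4 pp. 24–25] -/
theorem corridorStep_thin [NeZero d] (p : unitInterval) {η' : ℝ} {R₀' : ℕ}
    {wth : ℕ} (hT : ∀ δ' : ℝ, TargetPropertyThinAt d p (δ' + η') δ' (elongList d 88 (by norm_num)) R₀' wth)
    (S : CData d) (hS : S.Hyp p) (hSw : 2 * S.r ≤ wth) (R : ℕ) (h44 : 44 ≤ S.r) (hRc : 5 * R₀' + 5 ≤ S.r)
    (hΔ : 4 * ((S.lh : ℤ) + d * R + R₀') + 4 ≤ 7 * S.r) {δ' : ℝ}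
    (hB : 1 - δ' < (prodBernoulli (restrW (↑S.Uset : Set (Site d)) S.W)).real (⋃ b ∈ S.Bk d R, openConn S.o b)) :
    1 - (δ' + η') < (prodBernoulli (restrW (↑S.Uset : Set (Site d)) S.W)).real
      (⋃ b ∈ S.Tn (2 * S.r), openConn S.o b) := by
  -- `B_d⟨R₀'⟩ ⊆ Dcorr` and `Tn (2r) ⊆ Dcorr`
  have hw : ∀ i, S.hwid d R i = S.lh + d * R := fun i => by rw [S.hwid_apply, if_pos i.2]
  have hRc' : 5 * (R₀' : ℤ) + 5 ≤ S.r := by exact_mod_cast hRc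
  have hencl : Finset.Icc (S.c - S.hwid d R - (R₀' : Site d)) (S.c + S.hwid d R + (R₀' : Site d)) ⊆ S.Dcorr := by
    intro x hx
    rw [mem_Icc_iff] at hx
    simp only [Pi.sub_apply, Pi.add_apply, Pi.natCast_apply] at hx
    rw [S.mem_Dcorr_iff]
    have hlh : (0 : ℤ) ≤ S.lh := by positivity
    refine ⟨?_, fun j hj => ?_⟩
    · have := hx S.a; rw [hw] at this
      have hb := level_bounds_of_abs_le S.hσ (x := S.c S.a) (y := x S.a) (ℓ := S.lh + d * R + R₀')
        (by linarith) (by linarith)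
      have e : S.σ * (x S.a - S.c S.a) = S.σ * x S.a - S.σ * S.c S.a := by ring
      rw [e]; constructor <;> linarith [hb.1, hb.2]
    · have := hx j; rw [hw] at this
      constructor <;> linarith [this.1, this.2]
  have hTD : S.Tn (2 * S.r) ⊆ S.Dcorr := by
    intro x hx
    rw [S.mem_Tn_iff] at hx
    rw [S.mem_Dcorr_iff]
    push_cast at hx
    refine ⟨⟨by linarith [hx.1.1], by linarith [hx.1.2]⟩, fun j hj => ?_⟩
    have := hx.2 j hj
    constructor <;> linarith [this.1, this.2]
  exact hT δ' (restrW (↑S.Uset : Set (Site d)) S.W) S.Uset S.Dcorr (S.c - S.hwid d R) (S.c + S.hwid d R)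
    (S.Tn (2 * S.r)) S.o (finSupp_restrW S.Uset S.W)
    ((CData.isSubbox_Dcorr hS).restrW (Finset.coe_subset.2 (CData.Dcorr_subset_Uset hS)))
    (CData.Dcorr_subset_Uset hS) (Finset.mem_union_left _ (CData.o_mem_Aset hS)) (CData.o_not_mem_Dcorr hS)
    ⟨S.a, S.c, fun y hy i hi => by
      have h := ((S.mem_Dcorr_iff).1 hy).2 i hi
      have hw' : (2 * S.r : ℤ) ≤ wth := by exact_mod_cast hSw
      exact ⟨by linarith [h.1], by linarith [h.2]⟩⟩
    hencl
    (S.isTarget_corridor h44 hRc hΔ) hTD (S.Tn_nonempty _) hB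

/-- **Kozma–Nitzan's Lemma 12 with LINEAR loss and explicit scale threshold, thin inputs (`5r ≤ wth`).**  Given linear families of target
properties for the quarter faces (margin `R₀`, loss `η`) and for the aspect-`88` elongated geometries (margin
`R₀'`, loss `η'`), for every corridor datum `S` at parameter `p` (`S.Hyp p`) of scale
`S.r ≥ 100(d+1)(max R₀ R₀' + 1)`:
`1 − δ' < P_W(o ↔ c + [-3r,3r]^d in A) ⟹ 1 − (δ' + d·η + η') < P_W(o ↔ c' + [-3r,3r]^d in U)`
(tree `CData.corridorLemma_of_target`: `d` halving steps in `A`, one corridor step in `U`; here the losses add).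
builds on p205010 (kernel theorem, internal audit signed; external expert review pending).
[cite: KozmaNitzan2024, §4 Lemma 12 (pp. 23–25)] -/
theorem corridorLemma_thin [NeZero d] (p : unitInterval) {η η' : ℝ} {R₀ R₀' : ℕ}
    {wth : ℕ} (hT : ∀ δ' : ℝ, TargetPropertyThinAt d p (δ' + η) δ' (qfList d) R₀ wth)
    (hT' : ∀ δ' : ℝ, TargetPropertyThinAt d p (δ' + η') δ' (elongList d 88 (by norm_num)) R₀' wth)
    (S : CData d) (hS : S.Hyp p) (hSw : 5 * S.r ≤ wth) (hm : 100 * (d + 1) * (max R₀ R₀' + 1) ≤ S.r) {δ' : ℝ}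
    (hA : 1 - δ' < (prodBernoulli S.W).real
      (⋃ b ∈ Finset.Icc (S.c - ((3 * S.r : ℕ) : Site d)) (S.c + ((3 * S.r : ℕ) : Site d)),
        openConnIn (↑S.Aset : Set (Site d)) S.o b)) :
    1 - (δ' + d * η + η') < (prodBernoulli S.W).real
      (⋃ b ∈ S.Tn (3 * S.r), openConnIn (↑S.Uset : Set (Site d)) S.o b) := by
  set R : ℕ := max R₀ R₀' with hRdef
  -- arithmetic
  have hR1 : R₀' ≤ R := le_max_right _ _
  have hR2 : R₀ ≤ R := le_max_left _ _
  have hm' : 100 * ((d : ℤ) + 1) * (R + 1) ≤ S.r := by exact_mod_cast hm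
  have hd0 : (0 : ℤ) ≤ d := by positivity
  have hR0 : (0 : ℤ) ≤ R := by positivity
  have hdR : (0 : ℤ) ≤ d * R := by positivity
  have hexp : 100 * ((d : ℤ) + 1) * (R + 1) = 100 * (d * R) + 100 * d + 100 * R + 100 := by ring
  have hlh := S.two_lh
  have hhalf' : (((S.r + 1) / 2 : ℕ) : ℤ) + (S.r : ℤ) = S.lh := by unfold CData.lh; push_cast; ring
  have hRc' : (R₀' : ℤ) ≤ R := by exact_mod_cast hR1
  have hRh' : (R₀ : ℤ) ≤ R := by exact_mod_cast hR2
  -- into the restricted weighting on `A`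
  have ho : S.o ∈ (↑S.Aset : Set (Site d)) := Finset.mem_coe.2 (CData.o_mem_Aset hS)
  have h0 : 1 - δ' < (prodBernoulli (restrW (↑S.Aset : Set (Site d)) S.W)).real (⋃ b ∈ S.Bk 0 R, openConn S.o b) := by
    rw [S.Bk_zero, ← Finset.set_biUnion_coe, prodBernoulli_restrW_real_biUnion_openConn S.W _ ho,
      Finset.set_biUnion_coe]
    exact hA
  -- the halving chain
  have h1 := halvingChain_thin p hT d S hS hSw 0 R (by omega) hR2 ?_ ?_ h0
  rotate_left
  · have : (R : ℤ) ≤ S.lh := by linarith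
    have : (R₀ : ℤ) ≤ S.lh := by linarith
    exact_mod_cast this
  · have hdRh : (d : ℤ) * R ≤ d * R := le_rfl
    linarith
  rw [zero_add] at h1
  -- from `A` to `U`
  have hoU : S.o ∈ (↑S.Uset : Set (Site d)) := Finset.mem_coe.2 (S.Aset_subset_Uset (CData.o_mem_Aset hS))
  have h2 : 1 - (δ' + d * η) < (prodBernoulli (restrW (↑S.Uset : Set (Site d)) S.W)).real
      (⋃ b ∈ S.Bk d R, openConn S.o b) := by
    rw [← Finset.set_biUnion_coe, prodBernoulli_restrW_real_biUnion_openConn S.W _ hoU]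
    rw [← Finset.set_biUnion_coe, prodBernoulli_restrW_real_biUnion_openConn S.W _ ho] at h1
    exact h1.trans_le (measureReal_mono (biUnion_openConnIn_mono (Finset.coe_subset.2 S.Aset_subset_Uset) S.o subset_rfl)
      (measure_ne_top _ _))
  -- the corridor step
  have h3 := corridorStep_thin p hT' S hS (by omega) R ?_ ?_ ?_ h2
  rotate_left
  · have : (44 : ℤ) ≤ S.r := by linarith
    exact_mod_cast this
  · have : 5 * (R₀' : ℤ) + 5 ≤ S.r := by linarith
    exact_mod_cast this
  · have : (d : ℤ) * R₀' ≤ d * R := mul_le_mul_of_nonneg_left hRc' hd0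
    nlinarith
  -- back to `W`, and the larger target cube
  rw [← Finset.set_biUnion_coe, prodBernoulli_restrW_real_biUnion_openConn S.W _ hoU] at h3
  rw [← Finset.set_biUnion_coe]
  have e : δ' + (d : ℝ) * η + η' = δ' + d * η + η' := rfl
  refine h3.trans_le (measureReal_mono (biUnion_openConnIn_mono subset_rfl S.o (Finset.coe_subset.2 ?_))
    (measure_ne_top _ _))
  intro x hx
  rw [S.mem_Tn_iff] at hx ⊢
  push_cast at hx ⊢
  refine ⟨⟨by linarith [hx.1.1], by linarith [hx.1.2]⟩, fun j hj => ?_⟩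
  have := hx.2 j hj
  constructor <;> linarith [this.1, this.2]

end Summit.CriticalPhenomena.PercolationContinuityZ3.Theorems.Quant

end
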